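import Mathlib
import Literature.Analysis.FluidPDE.Tao2016AveragedNS.CascadeTableDictionary
import Literature.Analysis.FluidPDE.Tao2016AveragedNS.SelfSimilarCascadeBlowup
import Literature.Analysis.FluidPDE.Tao2016AveragedNS.ViscousDyadicMemberRegularity
import HarnessLib

/-!
# The SELF-DRAINED TWIN-FED PAIR `T(u,v)`: the (self, self) drain type of the blow-up-pair normal form
  (`…ExtinguishableCore`, `pair_normalForm_of_noGlobalCascade`) is the dyadic member ON ITS RAY — every global
  pseudo-solution of `dyadicTable` embeds as a global pseudo-solution of `T(u,v)` along the direction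
  `(1/(2v), 1/(2u), 0, 0)` with the SAME defect budget, so every non-blow-up theorem for the dyadic member kills the
  robust blow-up of `T(u,v)` from ray data (generalises `…TwinRotorPseudo`, the case `u = v = 1`; `--supports`
  stmt-NavierStokesRegularity-20206, K2(1) `TaoLadderRungTwoBreak.BlowupRigidityOne`)

MODEL lattice ODEs only (Tao 2016 §1.2, §4 (4.1)–(4.3), Lemma 4.1 (4.5)–(4.11), Thm. 4.2 statement shape); nothing here is a
statement about the Navier–Stokes equations; NO item is closed.  DEF-FREE (the table `T(u,v)`, the ray direction and the
embedded families are lambdas displayed in every statement); ROUTE-INDEPENDENT MODULE (no `Theses` import).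

THE TABLE `T(u,v)` (modes `a = 0`, `b = 1`; modes `2, 3` idle; parameters `u, v ∈ ℝ`).  Cross feeds
`α_{01 0,(0,0,1)} = α_{10 0,(0,0,1)} = u` (`x_0 x_1 ↦ y_0`) and `α_{01 1,(0,0,1)} = α_{10 1,(0,0,1)} = v` (`x_0 x_1 ↦ y_1`); SELF
drains `α_{10 0,(0,1,0)} = α_{01 0,(1,0,0)} = −u` (`x_1 y_0 ↦ x_0`: `y_0` drains its own twin below, catalysed by `x_1`) and
`α_{01 1,(0,1,0)} = α_{10 1,(1,0,0)} = −v` (`x_0 y_1 ↦ x_1`); everything else `0`.  Symmetric, cancelling; in `E₂(R)` as soon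
as `R⁻¹ ≤ |u|, |v| ≤ 1`.  By `pair_normalForm_of_noGlobalCascade` this is, up to the idle exterior, the (self, self) type
of a sub-dyadic blow-up pair; `T(1,1)` is the twin-rotor table of `…TwinRotorTableDefs`.

THE RAY.  With `c = (1/(2v), 1/(2u), 0, 0)` (`u, v ≠ 0`) the cascade nonlinearity of `T(u,v)` on the family
`X^p_{i,k} = c_i X_{0,k}` is `c_i · quadTerm(dyadicTable)` (`quadTerm_selfDrainPair`): the feed `2u·x_0x_1 = X²/(2v)`, the
drain `−u(x_1 y_0 + y_0 x_1) = −X Y/(2v)` on mode `0`, and the same with `u ↔ v` on mode `1`.  Hence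
(`cascadeODESolutionFrom_selfDrainPair_of_dyadic`) `(X, E) ↦ (c_i X_0, c_i² E_0)` maps global `(K₁,K₂)`-pseudo-solutions
of the dyadic member from `X₀` at shell `n₀` to global `(K₁,K₂)`-pseudo-solutions of `T(u,v)` from the RAY datum
`(c_i X₀ 0)_i` at shell `n₀`; so `HasGlobal` transfers, a robust blow-up of `T(u,v)` from a ray datum is a robust blow-up
of the dyadic member (`noGlobalCascade_dyadic_of_selfDrainPair`), and BMR's theorem at shell ratio `2`
(`not_noGlobalCascade_one_dyadicTable`) resp. the statement of item ⟨24644⟩ `DyadicBreakBelowOne` (by shape; certified in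
the tree on `ε₀ ∈ [9/25, 1]`) settle K2(1) / the rung leaf on `T(u,v)` from ray data at those ratios
(`not_noGlobalCascade_selfDrainPair_one`, `not_noGlobalCascade_selfDrainPair_of_dyadicBreak`).  Off-ray data are NOT
covered (the datum shell leaves the ray; the shells above it stay on it).

HONEST LABEL: dictionary work locating the (self,self) blow-up pairs inside the dyadic question (D) of the census; no stub,
crux, rung or summit is proved; rung 0.
-/

noncomputable section

-- the summit and its single sub-problem share the name (CONVENTIONS §1)
set_option linter.dupNamespace false

open Set MeasureTheory intervalIntegral

namespace Summit.NavierStokesRegularity.NavierStokesRegularity.Theorems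

namespace BlowupRigidityOne

open Literature.Analysis.FluidPDE Literature.Analysis.FluidPDE.TaoCascade

/-! ## The table `T(u,v)` -/

/-- `T(u,v)` is symmetric (4.2). [cite: Tao2016AveragedNS, §4 (4.2); cell vocabulary (`IsSymmetricCoeff`)] -/
theorem isSymmetricCoeff_selfDrainPair (u v : ℝ) :
    IsSymmetricCoeff (fun (i₁ i₂ i₃ : Fin 4) (μ : ℤ × ℤ × ℤ) => if μ = ((0 : ℤ), (0 : ℤ), (1 : ℤ)) then
        (if (i₁ = 0 ∧ i₂ = 1) ∨ (i₁ = 1 ∧ i₂ = 0) then (if i₃ = 0 then u else if i₃ = 1 then v else 0) else 0)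
      else if μ = ((1 : ℤ), (0 : ℤ), (0 : ℤ)) then
        (if i₁ = 0 ∧ i₂ = 1 ∧ i₃ = 0 then -u else if i₁ = 1 ∧ i₂ = 0 ∧ i₃ = 1 then -v else 0)
      else if μ = ((0 : ℤ), (1 : ℤ), (0 : ℤ)) then
        (if i₁ = 1 ∧ i₂ = 0 ∧ i₃ = 0 then -u else if i₁ = 0 ∧ i₂ = 1 ∧ i₃ = 1 then -v else 0) else 0) := by
  intro i₁ i₂ i₃ μ₁ μ₂ μ₃ hμ
  rw [mem_shiftSet_iff] at hμ
  simp only [Prod.mk.injEq] at hμ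
  rcases hμ with ⟨rfl, rfl, rfl⟩ | ⟨rfl, rfl, rfl⟩ | ⟨rfl, rfl, rfl⟩ | ⟨rfl, rfl, rfl⟩ <;>
    fin_cases i₁ <;> fin_cases i₂ <;> fin_cases i₃ <;> norm_num

/-- `T(u,v)` is cancelling (4.3): the two non-trivial orbits are `0 + u − u` and `0 + v − v`.
[cite: Tao2016AveragedNS, §4 (4.3); cell vocabulary (`IsCancellingCoeff`)] -/
theorem isCancellingCoeff_selfDrainPair (u v : ℝ) :
    IsCancellingCoeff (fun (i₁ i₂ i₃ : Fin 4) (μ : ℤ × ℤ × ℤ) => if μ = ((0 : ℤ), (0 : ℤ), (1 : ℤ)) then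
        (if (i₁ = 0 ∧ i₂ = 1) ∨ (i₁ = 1 ∧ i₂ = 0) then (if i₃ = 0 then u else if i₃ = 1 then v else 0) else 0)
      else if μ = ((1 : ℤ), (0 : ℤ), (0 : ℤ)) then
        (if i₁ = 0 ∧ i₂ = 1 ∧ i₃ = 0 then -u else if i₁ = 1 ∧ i₂ = 0 ∧ i₃ = 1 then -v else 0)
      else if μ = ((0 : ℤ), (1 : ℤ), (0 : ℤ)) then
        (if i₁ = 1 ∧ i₂ = 0 ∧ i₃ = 0 then -u else if i₁ = 0 ∧ i₂ = 1 ∧ i₃ = 1 then -v else 0) else 0) := by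
  intro i₁ i₂ i₃ μ₁ μ₂ μ₃ hμ
  rw [mem_shiftSet_iff] at hμ
  simp only [Prod.mk.injEq] at hμ
  rcases hμ with ⟨rfl, rfl, rfl⟩ | ⟨rfl, rfl, rfl⟩ | ⟨rfl, rfl, rfl⟩ | ⟨rfl, rfl, rfl⟩ <;>
    fin_cases i₁ <;> fin_cases i₂ <;> fin_cases i₃ <;> norm_num

/-- Every entry of `T(u,v)` is one of `0, u, v, −u, −v`. [cite: Tao2016AveragedNS, §4 (4.1); cell vocabulary] -/
theorem selfDrainPair_values (u v : ℝ) (i₁ i₂ i₃ : Fin 4) (μ : ℤ × ℤ × ℤ) :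
    (fun (i₁ i₂ i₃ : Fin 4) (μ : ℤ × ℤ × ℤ) => if μ = ((0 : ℤ), (0 : ℤ), (1 : ℤ)) then
        (if (i₁ = 0 ∧ i₂ = 1) ∨ (i₁ = 1 ∧ i₂ = 0) then (if i₃ = 0 then u else if i₃ = 1 then v else 0) else 0)
      else if μ = ((1 : ℤ), (0 : ℤ), (0 : ℤ)) then
        (if i₁ = 0 ∧ i₂ = 1 ∧ i₃ = 0 then -u else if i₁ = 1 ∧ i₂ = 0 ∧ i₃ = 1 then -v else 0)
      else if μ = ((0 : ℤ), (1 : ℤ), (0 : ℤ)) then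
        (if i₁ = 1 ∧ i₂ = 0 ∧ i₃ = 0 then -u else if i₁ = 0 ∧ i₂ = 1 ∧ i₃ = 1 then -v else 0) else 0) i₁ i₂ i₃ μ ∈ ({0, u, v, -u, -v} : Set ℝ) := by
  dsimp only
  split_ifs <;> simp

/-- **`T(u,v) ∈ E₂(R)` whenever `R⁻¹ ≤ |u| ≤ 1` and `R⁻¹ ≤ |v| ≤ 1`** (for `R < 2` these are exactly the admissible
moduli of a non-zero structure constant). [cite: Tao2016AveragedNS, §4 (4.2)–(4.3), §6.1; cell vocabulary (`InTableClass`)] -/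
theorem inTableClass_selfDrainPair {R u v : ℝ} (hu : R⁻¹ ≤ |u|) (hu1 : |u| ≤ 1) (hv : R⁻¹ ≤ |v|)
    (hv1 : |v| ≤ 1) : InTableClass R (fun (i₁ i₂ i₃ : Fin 4) (μ : ℤ × ℤ × ℤ) => if μ = ((0 : ℤ), (0 : ℤ), (1 : ℤ)) then
        (if (i₁ = 0 ∧ i₂ = 1) ∨ (i₁ = 1 ∧ i₂ = 0) then (if i₃ = 0 then u else if i₃ = 1 then v else 0) else 0)
      else if μ = ((1 : ℤ), (0 : ℤ), (0 : ℤ)) then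
        (if i₁ = 0 ∧ i₂ = 1 ∧ i₃ = 0 then -u else if i₁ = 1 ∧ i₂ = 0 ∧ i₃ = 1 then -v else 0)
      else if μ = ((0 : ℤ), (1 : ℤ), (0 : ℤ)) then
        (if i₁ = 1 ∧ i₂ = 0 ∧ i₃ = 0 then -u else if i₁ = 0 ∧ i₂ = 1 ∧ i₃ = 1 then -v else 0) else 0) := by
  refine ⟨isSymmetricCoeff_selfDrainPair u v, isCancellingCoeff_selfDrainPair u v, fun i₁ i₂ i₃ μ _ => ?_⟩
  have hval := selfDrainPair_values u v i₁ i₂ i₃ μ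
  dsimp only at hval ⊢
  simp only [Set.mem_insert_iff, Set.mem_singleton_iff] at hval
  rcases hval with h | h | h | h | h <;> rw [h]
  · simp
  · exact ⟨hu1, Or.inr hu⟩
  · exact ⟨hv1, Or.inr hv⟩
  · exact ⟨by rw [abs_neg]; exact hu1, Or.inr (by rw [abs_neg]; exact hu)⟩
  · exact ⟨by rw [abs_neg]; exact hv1, Or.inr (by rw [abs_neg]; exact hv)⟩

/-! ## `T(u,v)` on its ray -/

/-- Cross feed of `T(u,v)` on ray states: `Σ α_{i₁i₂i,(0,0,1)} (s c)_{i₁} (s' c)_{i₂} = s s' c_i` (`u, v ≠ 0`).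
[cite: Tao2016AveragedNS, §4 (4.1), Lemma 4.1 (4.8); cell vocabulary (`qform`)] -/
theorem qform_selfDrainPair_feed {u v : ℝ} (hu : u ≠ 0) (hv : v ≠ 0) (s s' : ℝ) (i : Fin 4) :
    qform (fun (i₁ i₂ i₃ : Fin 4) (μ : ℤ × ℤ × ℤ) => if μ = ((0 : ℤ), (0 : ℤ), (1 : ℤ)) then
        (if (i₁ = 0 ∧ i₂ = 1) ∨ (i₁ = 1 ∧ i₂ = 0) then (if i₃ = 0 then u else if i₃ = 1 then v else 0) else 0)
      else if μ = ((1 : ℤ), (0 : ℤ), (0 : ℤ)) then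
        (if i₁ = 0 ∧ i₂ = 1 ∧ i₃ = 0 then -u else if i₁ = 1 ∧ i₂ = 0 ∧ i₃ = 1 then -v else 0)
      else if μ = ((0 : ℤ), (1 : ℤ), (0 : ℤ)) then
        (if i₁ = 1 ∧ i₂ = 0 ∧ i₃ = 0 then -u else if i₁ = 0 ∧ i₂ = 1 ∧ i₃ = 1 then -v else 0) else 0) (0, 0, 1) (s • (WithLp.toLp 2 (fun i : Fin 4 => if i = 0 then (2 * v)⁻¹ else if i = 1 then (2 * u)⁻¹ else (0 : ℝ)) : Em 4)) (s' • (WithLp.toLp 2 (fun i : Fin 4 => if i = 0 then (2 * v)⁻¹ else if i = 1 then (2 * u)⁻¹ else (0 : ℝ)) : Em 4)) i = s * s' * (fun i : Fin 4 => if i = 0 then (2 * v)⁻¹ else if i = 1 then (2 * u)⁻¹ else (0 : ℝ)) i := by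
  unfold qform
  fin_cases i <;> simp [Fin.sum_univ_four] <;> field_simp <;> ring

/-- `(1,0,0)` drain of `T(u,v)` on ray states (shell above holds `s c`, shell below `s' c`): `−(s s'/2) c_i`.
[cite: Tao2016AveragedNS, §4 (4.1), Lemma 4.1 (4.8); cell vocabulary (`qform`)] -/
theorem qform_selfDrainPair_back₁ {u v : ℝ} (hu : u ≠ 0) (hv : v ≠ 0) (s s' : ℝ) (i : Fin 4) :
    qform (fun (i₁ i₂ i₃ : Fin 4) (μ : ℤ × ℤ × ℤ) => if μ = ((0 : ℤ), (0 : ℤ), (1 : ℤ)) then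
        (if (i₁ = 0 ∧ i₂ = 1) ∨ (i₁ = 1 ∧ i₂ = 0) then (if i₃ = 0 then u else if i₃ = 1 then v else 0) else 0)
      else if μ = ((1 : ℤ), (0 : ℤ), (0 : ℤ)) then
        (if i₁ = 0 ∧ i₂ = 1 ∧ i₃ = 0 then -u else if i₁ = 1 ∧ i₂ = 0 ∧ i₃ = 1 then -v else 0)
      else if μ = ((0 : ℤ), (1 : ℤ), (0 : ℤ)) then
        (if i₁ = 1 ∧ i₂ = 0 ∧ i₃ = 0 then -u else if i₁ = 0 ∧ i₂ = 1 ∧ i₃ = 1 then -v else 0) else 0) (1, 0, 0) (s • (WithLp.toLp 2 (fun i : Fin 4 => if i = 0 then (2 * v)⁻¹ else if i = 1 then (2 * u)⁻¹ else (0 : ℝ)) : Em 4)) (s' • (WithLp.toLp 2 (fun i : Fin 4 => if i = 0 then (2 * v)⁻¹ else if i = 1 then (2 * u)⁻¹ else (0 : ℝ)) : Em 4)) i = -(s * s' / 2) * (fun i : Fin 4 => if i = 0 then (2 * v)⁻¹ else if i = 1 then (2 * u)⁻¹ else (0 : ℝ)) i := by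
  unfold qform
  fin_cases i <;> simp [Fin.sum_univ_four] <;> field_simp

/-- `(0,1,0)` drain of `T(u,v)` on ray states (shell below holds `s' c`, shell above `s c`): `−(s s'/2) c_i`.
[cite: Tao2016AveragedNS, §4 (4.1), Lemma 4.1 (4.8); cell vocabulary (`qform`)] -/
theorem qform_selfDrainPair_back₂ {u v : ℝ} (hu : u ≠ 0) (hv : v ≠ 0) (s s' : ℝ) (i : Fin 4) :
    qform (fun (i₁ i₂ i₃ : Fin 4) (μ : ℤ × ℤ × ℤ) => if μ = ((0 : ℤ), (0 : ℤ), (1 : ℤ)) then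
        (if (i₁ = 0 ∧ i₂ = 1) ∨ (i₁ = 1 ∧ i₂ = 0) then (if i₃ = 0 then u else if i₃ = 1 then v else 0) else 0)
      else if μ = ((1 : ℤ), (0 : ℤ), (0 : ℤ)) then
        (if i₁ = 0 ∧ i₂ = 1 ∧ i₃ = 0 then -u else if i₁ = 1 ∧ i₂ = 0 ∧ i₃ = 1 then -v else 0)
      else if μ = ((0 : ℤ), (1 : ℤ), (0 : ℤ)) then
        (if i₁ = 1 ∧ i₂ = 0 ∧ i₃ = 0 then -u else if i₁ = 0 ∧ i₂ = 1 ∧ i₃ = 1 then -v else 0) else 0) (0, 1, 0) (s' • (WithLp.toLp 2 (fun i : Fin 4 => if i = 0 then (2 * v)⁻¹ else if i = 1 then (2 * u)⁻¹ else (0 : ℝ)) : Em 4)) (s • (WithLp.toLp 2 (fun i : Fin 4 => if i = 0 then (2 * v)⁻¹ else if i = 1 then (2 * u)⁻¹ else (0 : ℝ)) : Em 4)) i = -(s * s' / 2) * (fun i : Fin 4 => if i = 0 then (2 * v)⁻¹ else if i = 1 then (2 * u)⁻¹ else (0 : ℝ)) i := by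
  unfold qform
  fin_cases i <;> simp [Fin.sum_univ_four] <;> field_simp

/-- `T(u,v)` has no intra-shell block. [cite: Tao2016AveragedNS, §4 (4.1); cell vocabulary (`qform`)] -/
theorem qform_selfDrainPair_intra (u v : ℝ) (x y : Em 4) (i : Fin 4) :
    qform (fun (i₁ i₂ i₃ : Fin 4) (μ : ℤ × ℤ × ℤ) => if μ = ((0 : ℤ), (0 : ℤ), (1 : ℤ)) then
        (if (i₁ = 0 ∧ i₂ = 1) ∨ (i₁ = 1 ∧ i₂ = 0) then (if i₃ = 0 then u else if i₃ = 1 then v else 0) else 0)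
      else if μ = ((1 : ℤ), (0 : ℤ), (0 : ℤ)) then
        (if i₁ = 0 ∧ i₂ = 1 ∧ i₃ = 0 then -u else if i₁ = 1 ∧ i₂ = 0 ∧ i₃ = 1 then -v else 0)
      else if μ = ((0 : ℤ), (1 : ℤ), (0 : ℤ)) then
        (if i₁ = 1 ∧ i₂ = 0 ∧ i₃ = 0 then -u else if i₁ = 0 ∧ i₂ = 1 ∧ i₃ = 1 then -v else 0) else 0) (0, 0, 0) x y i = 0 := by
  unfold qform
  fin_cases i <;> simp

/-- The shell vectors of the ray family are ray states: `x^p_k = X_{0,k} • c`.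
[cite: Tao2016AveragedNS, §4 Lemma 4.1 (the amplitudes of one shell); cell vocabulary (`shellVec`)] -/
theorem shellVec_selfDrainPair (u v : ℝ) (X : Fin 4 → ℤ → ℝ → ℝ) (k : ℤ) (t : ℝ) :
    shellVec (fun i k t => (fun i : Fin 4 => if i = 0 then (2 * v)⁻¹ else if i = 1 then (2 * u)⁻¹ else (0 : ℝ)) i * X 0 k t) k t = X 0 k t • (WithLp.toLp 2 (fun i : Fin 4 => if i = 0 then (2 * v)⁻¹ else if i = 1 then (2 * u)⁻¹ else (0 : ℝ)) : Em 4) := by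
  ext i
  simp only [shellVec_apply, PiLp.smul_apply, smul_eq_mul]
  split_ifs <;> ring

/-- **On the ray the cascade nonlinearity of `T(u,v)` is `c_i` times the dyadic one**:
`quadTerm^p_{i,n} = c_i (Λ_{n−1} X_{0,n−1}² − Λ_n X_{0,n} X_{0,n+1})` (`u, v ≠ 0`).
[cite: Tao2016AveragedNS, §1.2 (dyadic model), §4 (4.1), Lemma 4.1 (4.8); tree `quadTerm_eq_tables`, `quadTerm_dyadicTable_zero`] -/
theorem quadTerm_selfDrainPair {u v : ℝ} (hu : u ≠ 0) (hv : v ≠ 0) (ε₀ : ℝ) (X : Fin 4 → ℤ → ℝ → ℝ)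
    (i : Fin 4) (n : ℤ) (t : ℝ) :
    quadTerm ε₀ (fun (i₁ i₂ i₃ : Fin 4) (μ : ℤ × ℤ × ℤ) => if μ = ((0 : ℤ), (0 : ℤ), (1 : ℤ)) then
        (if (i₁ = 0 ∧ i₂ = 1) ∨ (i₁ = 1 ∧ i₂ = 0) then (if i₃ = 0 then u else if i₃ = 1 then v else 0) else 0)
      else if μ = ((1 : ℤ), (0 : ℤ), (0 : ℤ)) then
        (if i₁ = 0 ∧ i₂ = 1 ∧ i₃ = 0 then -u else if i₁ = 1 ∧ i₂ = 0 ∧ i₃ = 1 then -v else 0)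
      else if μ = ((0 : ℤ), (1 : ℤ), (0 : ℤ)) then
        (if i₁ = 1 ∧ i₂ = 0 ∧ i₃ = 0 then -u else if i₁ = 0 ∧ i₂ = 1 ∧ i₃ = 1 then -v else 0) else 0) (fun i k t => (fun i : Fin 4 => if i = 0 then (2 * v)⁻¹ else if i = 1 then (2 * u)⁻¹ else (0 : ℝ)) i * X 0 k t) i n t =
      (fun i : Fin 4 => if i = 0 then (2 * v)⁻¹ else if i = 1 then (2 * u)⁻¹ else (0 : ℝ)) i * quadTerm ε₀ dyadicTable X 0 n t := by
  rw [quadTerm_eq_tables, shellVec_selfDrainPair, shellVec_selfDrainPair, shellVec_selfDrainPair, tableQ_apply,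
    tableA_apply, tableB_apply, qform_selfDrainPair_intra, qform_selfDrainPair_feed hu hv,
    qform_selfDrainPair_back₁ hu hv, qform_selfDrainPair_back₂ hu hv, quadTerm_dyadicTable_zero]
  ring

/-! ## Global pseudo-solutions of the dyadic member embed along the ray -/

/-- `√(c² E) = |c| √E`. [elementary] -/
theorem sqrt_sq_mul' (c E : ℝ) : Real.sqrt (c ^ 2 * E) = |c| * Real.sqrt E := by
  rw [Real.sqrt_mul (sq_nonneg c), Real.sqrt_sq_eq_abs]

/-- **THE RAY EMBEDDING OF PSEUDO-SOLUTIONS.**  For `ε₀ > −1` and `u, v ≠ 0`: if `(X, E)` obeys the conclusions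
(4.5)–(4.11) of Lemma 4.1 for the dyadic member with defect constants `(K₁, K₂)` from the one-shell datum `X₀` at shell
`n₀`, then the ray family `X^p_{i,k} = c_i X_{0,k}` with energies `E^p_{i,k} = c_i² E_{0,k}`, `c = (1/(2v), 1/(2u), 0, 0)`,
obeys them for `T(u,v)` with the SAME `(K₁, K₂)` from the ray datum `(c_i X₀ 0)_i` at shell `n₀`: (4.5) (amplitudes scale
by `|c_i|`), (4.6)–(4.7), the motion law (4.8) (`quadTerm_selfDrainPair`: both sides scale by `|c_i|`,
`√(c² E) = |c| √E`), the energy inequality (4.9) and the defect bounds (4.10) (both sides scale by `c_i²`), (4.11).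
[cite: Tao2016AveragedNS, §1.2, §4 Lemma 4.1 (4.5)–(4.11); cell vocabulary (`CascadeODESolutionFrom`)] -/
theorem cascadeODESolutionFrom_selfDrainPair_of_dyadic {u v ε₀ K₁ K₂ : ℝ} {n₀ : ℤ} {X₀ : Fin 4 → ℝ}
    {X E : Fin 4 → ℤ → ℝ → ℝ} (hu : u ≠ 0) (hv : v ≠ 0) (hε : -1 < ε₀)
    (h : CascadeODESolutionFrom ε₀ dyadicTable K₁ K₂ n₀ X₀ X E) :
    CascadeODESolutionFrom ε₀ (fun (i₁ i₂ i₃ : Fin 4) (μ : ℤ × ℤ × ℤ) => if μ = ((0 : ℤ), (0 : ℤ), (1 : ℤ)) then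
        (if (i₁ = 0 ∧ i₂ = 1) ∨ (i₁ = 1 ∧ i₂ = 0) then (if i₃ = 0 then u else if i₃ = 1 then v else 0) else 0)
      else if μ = ((1 : ℤ), (0 : ℤ), (0 : ℤ)) then
        (if i₁ = 0 ∧ i₂ = 1 ∧ i₃ = 0 then -u else if i₁ = 1 ∧ i₂ = 0 ∧ i₃ = 1 then -v else 0)
      else if μ = ((0 : ℤ), (1 : ℤ), (0 : ℤ)) then
        (if i₁ = 1 ∧ i₂ = 0 ∧ i₃ = 0 then -u else if i₁ = 0 ∧ i₂ = 1 ∧ i₃ = 1 then -v else 0) else 0) K₁ K₂ n₀ (fun i => (fun i : Fin 4 => if i = 0 then (2 * v)⁻¹ else if i = 1 then (2 * u)⁻¹ else (0 : ℝ)) i * X₀ 0)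
      (fun i k t => (fun i : Fin 4 => if i = 0 then (2 * v)⁻¹ else if i = 1 then (2 * u)⁻¹ else (0 : ℝ)) i * X 0 k t)
      (fun i k t => (fun i : Fin 4 => if i = 0 then (2 * v)⁻¹ else if i = 1 then (2 * u)⁻¹ else (0 : ℝ)) i ^ 2 * E 0 k t) where
  contDiffOn_X i n := contDiffOn_const.mul (h.contDiffOn_X 0 n)
  contDiffOn_E i n := contDiffOn_const.mul (h.contDiffOn_E 0 n)
  nonneg_E i n t ht := mul_nonneg (sq_nonneg _) (h.nonneg_E 0 n t ht)
  apriori_X T hT := by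
    obtain ⟨M, hM⟩ := h.apriori_X T hT
    have h1 : (0 : ℝ) < 1 + ε₀ := by linarith
    have hM0 : 0 ≤ M := le_trans (mul_nonneg (by positivity) (abs_nonneg _)) (hM 0 ⟨le_rfl, hT.le⟩ 0 0)
    refine ⟨(1 + |(2 * v)⁻¹| + |(2 * u)⁻¹|) * M, fun t ht i n => ?_⟩
    have hw : 0 ≤ 1 + (1 + ε₀) ^ ((10 : ℝ) * n) := by positivity
    have hMn := hM t ht 0 n
    have hc : |(fun i : Fin 4 => if i = 0 then (2 * v)⁻¹ else if i = 1 then (2 * u)⁻¹ else (0 : ℝ)) i| ≤ 1 + |(2 * v)⁻¹| + |(2 * u)⁻¹| := by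
      dsimp only
      split_ifs
      · linarith [abs_nonneg (2 * u)⁻¹]
      · linarith [abs_nonneg (2 * v)⁻¹]
      · rw [abs_zero]; positivity
    calc (1 + (1 + ε₀) ^ ((10 : ℝ) * n)) * |(fun i : Fin 4 => if i = 0 then (2 * v)⁻¹ else if i = 1 then (2 * u)⁻¹ else (0 : ℝ)) i * X 0 n t|
        = |(fun i : Fin 4 => if i = 0 then (2 * v)⁻¹ else if i = 1 then (2 * u)⁻¹ else (0 : ℝ)) i| * ((1 + (1 + ε₀) ^ ((10 : ℝ) * n)) * |X 0 n t|) := by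
          rw [abs_mul]; ring
      _ ≤ (1 + |(2 * v)⁻¹| + |(2 * u)⁻¹|) * M :=
          mul_le_mul hc hMn (mul_nonneg hw (abs_nonneg _)) (by positivity)
  apriori_E T hT := by
    obtain ⟨M, hM⟩ := h.apriori_E T hT
    have h1 : (0 : ℝ) < 1 + ε₀ := by linarith
    have hM0 : 0 ≤ M :=
      le_trans (mul_nonneg (by positivity) (Real.sqrt_nonneg _)) (hM 0 ⟨le_rfl, hT.le⟩ 0 0)
    refine ⟨(1 + |(2 * v)⁻¹| + |(2 * u)⁻¹|) * M, fun t ht i n => ?_⟩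
    have hw : 0 ≤ 1 + (1 + ε₀) ^ ((10 : ℝ) * n) := by positivity
    have hMn := hM t ht 0 n
    have hc : |(fun i : Fin 4 => if i = 0 then (2 * v)⁻¹ else if i = 1 then (2 * u)⁻¹ else (0 : ℝ)) i| ≤ 1 + |(2 * v)⁻¹| + |(2 * u)⁻¹| := by
      dsimp only
      split_ifs
      · linarith [abs_nonneg (2 * u)⁻¹]
      · linarith [abs_nonneg (2 * v)⁻¹]
      · rw [abs_zero]; positivity
    calc (1 + (1 + ε₀) ^ ((10 : ℝ) * n)) * Real.sqrt ((fun i : Fin 4 => if i = 0 then (2 * v)⁻¹ else if i = 1 then (2 * u)⁻¹ else (0 : ℝ)) i ^ 2 * E 0 n t)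
        = |(fun i : Fin 4 => if i = 0 then (2 * v)⁻¹ else if i = 1 then (2 * u)⁻¹ else (0 : ℝ)) i| * ((1 + (1 + ε₀) ^ ((10 : ℝ) * n)) * Real.sqrt (E 0 n t)) := by
          rw [sqrt_sq_mul']; ring
      _ ≤ (1 + |(2 * v)⁻¹| + |(2 * u)⁻¹|) * M :=
          mul_le_mul hc hMn (mul_nonneg hw (Real.sqrt_nonneg _)) (by positivity)
  init_E i n := by
    dsimp only
    rw [h.init_E]
    ring
  init_X i n := by
    dsimp only
    rw [h.init_X]
    split_ifs <;> ring
  motion i n t ht := by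
    rw [quadTerm_selfDrainPair hu hv, derivWithin_const_mul_field, ← mul_sub, abs_mul, sqrt_sq_mul']
    have := h.motion 0 n t ht
    calc |(fun i : Fin 4 => if i = 0 then (2 * v)⁻¹ else if i = 1 then (2 * u)⁻¹ else (0 : ℝ)) i| * |derivWithin (X 0 n) (Ici 0) t - quadTerm ε₀ dyadicTable X 0 n t|
        ≤ |(fun i : Fin 4 => if i = 0 then (2 * v)⁻¹ else if i = 1 then (2 * u)⁻¹ else (0 : ℝ)) i| * (K₁ * (1 + ε₀) ^ ((2 : ℝ) * n) * Real.sqrt (E 0 n t)) :=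
          mul_le_mul_of_nonneg_left this (abs_nonneg _)
      _ = K₁ * (1 + ε₀) ^ ((2 : ℝ) * n) * (|(fun i : Fin 4 => if i = 0 then (2 * v)⁻¹ else if i = 1 then (2 * u)⁻¹ else (0 : ℝ)) i| * Real.sqrt (E 0 n t)) := by ring
  energy i n t ht := by
    rw [quadTerm_selfDrainPair hu hv, derivWithin_const_mul_field]
    have := h.energy 0 n t ht
    have hc2 : 0 ≤ (fun i : Fin 4 => if i = 0 then (2 * v)⁻¹ else if i = 1 then (2 * u)⁻¹ else (0 : ℝ)) i ^ 2 := sq_nonneg _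
    calc (fun i : Fin 4 => if i = 0 then (2 * v)⁻¹ else if i = 1 then (2 * u)⁻¹ else (0 : ℝ)) i ^ 2 * derivWithin (E 0 n) (Ici 0) t
        ≤ (fun i : Fin 4 => if i = 0 then (2 * v)⁻¹ else if i = 1 then (2 * u)⁻¹ else (0 : ℝ)) i ^ 2 * (quadTerm ε₀ dyadicTable X 0 n t * X 0 n t) :=
          mul_le_mul_of_nonneg_left this hc2
      _ = (fun i : Fin 4 => if i = 0 then (2 * v)⁻¹ else if i = 1 then (2 * u)⁻¹ else (0 : ℝ)) i * quadTerm ε₀ dyadicTable X 0 n t * ((fun i : Fin 4 => if i = 0 then (2 * v)⁻¹ else if i = 1 then (2 * u)⁻¹ else (0 : ℝ)) i * X 0 n t) := by ring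
  defect_lower i n t ht := by
    have := h.defect_lower 0 n t ht
    have hc2 : 0 ≤ (fun i : Fin 4 => if i = 0 then (2 * v)⁻¹ else if i = 1 then (2 * u)⁻¹ else (0 : ℝ)) i ^ 2 := sq_nonneg _
    calc 1 / 2 * ((fun i : Fin 4 => if i = 0 then (2 * v)⁻¹ else if i = 1 then (2 * u)⁻¹ else (0 : ℝ)) i * X 0 n t) ^ 2 = (fun i : Fin 4 => if i = 0 then (2 * v)⁻¹ else if i = 1 then (2 * u)⁻¹ else (0 : ℝ)) i ^ 2 * (1 / 2 * X 0 n t ^ 2) := by ring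
      _ ≤ (fun i : Fin 4 => if i = 0 then (2 * v)⁻¹ else if i = 1 then (2 * u)⁻¹ else (0 : ℝ)) i ^ 2 * E 0 n t := mul_le_mul_of_nonneg_left this hc2
  defect_upper i n t ht := by
    have := h.defect_upper 0 n t ht
    have hc2 : 0 ≤ (fun i : Fin 4 => if i = 0 then (2 * v)⁻¹ else if i = 1 then (2 * u)⁻¹ else (0 : ℝ)) i ^ 2 := sq_nonneg _
    rw [intervalIntegral.integral_const_mul]
    calc (fun i : Fin 4 => if i = 0 then (2 * v)⁻¹ else if i = 1 then (2 * u)⁻¹ else (0 : ℝ)) i ^ 2 * E 0 n t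
        ≤ (fun i : Fin 4 => if i = 0 then (2 * v)⁻¹ else if i = 1 then (2 * u)⁻¹ else (0 : ℝ)) i ^ 2 * (1 / 2 * X 0 n t ^ 2 + K₂ * (1 + ε₀) ^ ((2 : ℝ) * n) * ∫ s in (0 : ℝ)..t, E 0 n s) :=
          mul_le_mul_of_nonneg_left this hc2
      _ = 1 / 2 * ((fun i : Fin 4 => if i = 0 then (2 * v)⁻¹ else if i = 1 then (2 * u)⁻¹ else (0 : ℝ)) i * X 0 n t) ^ 2 +
            K₂ * (1 + ε₀) ^ ((2 : ℝ) * n) * ((fun i : Fin 4 => if i = 0 then (2 * v)⁻¹ else if i = 1 then (2 * u)⁻¹ else (0 : ℝ)) i ^ 2 * ∫ s in (0 : ℝ)..t, E 0 n s) := by ring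
  noLow_X i n t hn ht := by
    dsimp only
    rw [h.noLow_X 0 n t hn ht, mul_zero]
  noLow_E i n t hn ht := by
    dsimp only
    rw [h.noLow_E 0 n t hn ht, mul_zero]

/-- **`HasGlobal` transfers from the dyadic member to the ray datum of `T(u,v)`**, same `ε₀ > −1`, same defect constants,
same starting shell. [cite: Tao2016AveragedNS, §4 Lemma 4.1 (4.5)–(4.11); cell vocabulary (`HasGlobal`)] -/
theorem hasGlobal_selfDrainPair_of_dyadic {u v ε₀ K₁ K₂ : ℝ} {n₀ : ℤ} {X₀ : Fin 4 → ℝ} (hu : u ≠ 0) (hv : v ≠ 0)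
    (hε : -1 < ε₀) (h : HasGlobal ε₀ dyadicTable K₁ K₂ n₀ X₀) :
    HasGlobal ε₀ (fun (i₁ i₂ i₃ : Fin 4) (μ : ℤ × ℤ × ℤ) => if μ = ((0 : ℤ), (0 : ℤ), (1 : ℤ)) then
        (if (i₁ = 0 ∧ i₂ = 1) ∨ (i₁ = 1 ∧ i₂ = 0) then (if i₃ = 0 then u else if i₃ = 1 then v else 0) else 0)
      else if μ = ((1 : ℤ), (0 : ℤ), (0 : ℤ)) then
        (if i₁ = 0 ∧ i₂ = 1 ∧ i₃ = 0 then -u else if i₁ = 1 ∧ i₂ = 0 ∧ i₃ = 1 then -v else 0)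
      else if μ = ((0 : ℤ), (1 : ℤ), (0 : ℤ)) then
        (if i₁ = 1 ∧ i₂ = 0 ∧ i₃ = 0 then -u else if i₁ = 0 ∧ i₂ = 1 ∧ i₃ = 1 then -v else 0) else 0) K₁ K₂ n₀ (fun i => (fun i : Fin 4 => if i = 0 then (2 * v)⁻¹ else if i = 1 then (2 * u)⁻¹ else (0 : ℝ)) i * X₀ 0) := by
  obtain ⟨X, E, hXE⟩ := h
  exact ⟨_, _, cascadeODESolutionFrom_selfDrainPair_of_dyadic hu hv hε hXE⟩

/-- **A robust blow-up of `T(u,v)` from a ray datum is a robust blow-up of the dyadic member** (`ε₀ > −1`, `u, v ≠ 0`):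
for each budget and each large shell a dyadic global pseudo-solution would embed along the ray.
[cite: Tao2016AveragedNS, §4 Thm. 4.2 (statement shape); cell vocabulary (`NoGlobalCascade`)] -/
theorem noGlobalCascade_dyadic_of_selfDrainPair {u v ε₀ : ℝ} {X₀ : Fin 4 → ℝ} (hu : u ≠ 0) (hv : v ≠ 0)
    (hε : -1 < ε₀) (h : NoGlobalCascade ε₀ (fun (i₁ i₂ i₃ : Fin 4) (μ : ℤ × ℤ × ℤ) => if μ = ((0 : ℤ), (0 : ℤ), (1 : ℤ)) then
        (if (i₁ = 0 ∧ i₂ = 1) ∨ (i₁ = 1 ∧ i₂ = 0) then (if i₃ = 0 then u else if i₃ = 1 then v else 0) else 0)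
      else if μ = ((1 : ℤ), (0 : ℤ), (0 : ℤ)) then
        (if i₁ = 0 ∧ i₂ = 1 ∧ i₃ = 0 then -u else if i₁ = 1 ∧ i₂ = 0 ∧ i₃ = 1 then -v else 0)
      else if μ = ((0 : ℤ), (1 : ℤ), (0 : ℤ)) then
        (if i₁ = 1 ∧ i₂ = 0 ∧ i₃ = 0 then -u else if i₁ = 0 ∧ i₂ = 1 ∧ i₃ = 1 then -v else 0) else 0) (fun i => (fun i : Fin 4 => if i = 0 then (2 * v)⁻¹ else if i = 1 then (2 * u)⁻¹ else (0 : ℝ)) i * X₀ 0)) :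
    NoGlobalCascade ε₀ dyadicTable X₀ := by
  intro K₁ K₂ hK₁ hK₂
  obtain ⟨N₀, hN₀⟩ := h K₁ K₂ hK₁ hK₂
  exact ⟨N₀, fun n₀ hn₀ hglob => hN₀ n₀ hn₀ (hasGlobal_selfDrainPair_of_dyadic hu hv hε hglob)⟩

/-- **Every non-blow-up theorem for the dyadic member kills the ray blow-up of `T(u,v)`** (`ε₀ > −1`, `u, v ≠ 0`).
[cite: Tao2016AveragedNS, §4 Thm. 4.2 (statement shape); cell vocabulary (`NoGlobalCascade`)] -/
theorem not_noGlobalCascade_selfDrainPair_of_dyadic {u v ε₀ : ℝ} {X₀ : Fin 4 → ℝ} (hu : u ≠ 0) (hv : v ≠ 0)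
    (hε : -1 < ε₀) (h : ¬ NoGlobalCascade ε₀ dyadicTable X₀) :
    ¬ NoGlobalCascade ε₀ (fun (i₁ i₂ i₃ : Fin 4) (μ : ℤ × ℤ × ℤ) => if μ = ((0 : ℤ), (0 : ℤ), (1 : ℤ)) then
        (if (i₁ = 0 ∧ i₂ = 1) ∨ (i₁ = 1 ∧ i₂ = 0) then (if i₃ = 0 then u else if i₃ = 1 then v else 0) else 0)
      else if μ = ((1 : ℤ), (0 : ℤ), (0 : ℤ)) then
        (if i₁ = 0 ∧ i₂ = 1 ∧ i₃ = 0 then -u else if i₁ = 1 ∧ i₂ = 0 ∧ i₃ = 1 then -v else 0)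
      else if μ = ((0 : ℤ), (1 : ℤ), (0 : ℤ)) then
        (if i₁ = 1 ∧ i₂ = 0 ∧ i₃ = 0 then -u else if i₁ = 0 ∧ i₂ = 1 ∧ i₃ = 1 then -v else 0) else 0) (fun i => (fun i : Fin 4 => if i = 0 then (2 * v)⁻¹ else if i = 1 then (2 * u)⁻¹ else (0 : ℝ)) i * X₀ 0) :=
  fun hp => h (noGlobalCascade_dyadic_of_selfDrainPair hu hv hε hp)

/-! ## Consequences: BMR at shell ratio 2, and the dyadic break below one -/

/-- **AT `ε₀ = 1`, `T(u,v)` DOES NOT BLOW UP ROBUSTLY FROM A RAY DATUM** `(a/(2v), a/(2u), 0, 0)`, `a ≥ 0`: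
Barbato–Morandin–Romito's Theorem 1 for the dyadic member (tree `not_noGlobalCascade_one_dyadicTable`) transported along
the ray.  K2(1) and the rung leaf hold there vacuously.
[cite: BarbatoMorandinRomito2011, Thm. 1] [cite: Tao2016AveragedNS, §1.2, §4 Thm. 4.2; cell vocabulary (`NoGlobalCascade`)] -/
theorem not_noGlobalCascade_selfDrainPair_one {u v a : ℝ} (hu : u ≠ 0) (hv : v ≠ 0) (ha : 0 ≤ a) :
    ¬ NoGlobalCascade 1 (fun (i₁ i₂ i₃ : Fin 4) (μ : ℤ × ℤ × ℤ) => if μ = ((0 : ℤ), (0 : ℤ), (1 : ℤ)) then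
        (if (i₁ = 0 ∧ i₂ = 1) ∨ (i₁ = 1 ∧ i₂ = 0) then (if i₃ = 0 then u else if i₃ = 1 then v else 0) else 0)
      else if μ = ((1 : ℤ), (0 : ℤ), (0 : ℤ)) then
        (if i₁ = 0 ∧ i₂ = 1 ∧ i₃ = 0 then -u else if i₁ = 1 ∧ i₂ = 0 ∧ i₃ = 1 then -v else 0)
      else if μ = ((0 : ℤ), (1 : ℤ), (0 : ℤ)) then
        (if i₁ = 1 ∧ i₂ = 0 ∧ i₃ = 0 then -u else if i₁ = 0 ∧ i₂ = 1 ∧ i₃ = 1 then -v else 0) else 0) (fun i => (fun i : Fin 4 => if i = 0 then (2 * v)⁻¹ else if i = 1 then (2 * u)⁻¹ else (0 : ℝ)) i * a) := by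
  have h := not_noGlobalCascade_selfDrainPair_of_dyadic (u := u) (v := v)
    (X₀ := fun i => if i = (0 : Fin 4) then a else 0) hu hv (by norm_num : (-1 : ℝ) < 1)
    (not_noGlobalCascade_one_dyadicTable (X₀ := fun i => if i = (0 : Fin 4) then a else 0)
      (by simp [ha]) (fun i hi => if_neg hi))
  simpa using h

/-- **THE DYADIC BREAK BELOW ONE KILLS THE RAY BLOW-UP OF `T(u,v)` AT EVERY `ε₀ ∈ (0,1)`.**  The statement of item
⟨24644⟩ `OrthantWake.DyadicBreakBelowOne` (hypothesis `hD`, spelled out; certified in the tree on `ε₀ ∈ [9/25, 1]`) gives: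
for every `ε₀ ∈ (0,1)`, every `u, v ≠ 0` and every `X₀`, `T(u,v)` does not blow up robustly from the ray datum
`(X₀ 0/(2v), X₀ 0/(2u), 0, 0)`.
[cite: BarbatoMorandinRomito2011, Thm. 1] [cite: Tao2016AveragedNS, §4 Thm. 4.2; cell vocabulary (`NoGlobalCascade`, `OrthantWake.DyadicBreakBelowOne`)] -/
theorem not_noGlobalCascade_selfDrainPair_of_dyadicBreak
    (hD : ∀ ε₀ : ℝ, 0 < ε₀ → ε₀ < 1 → ∀ X₀ : Fin 4 → ℝ, ¬ NoGlobalCascade ε₀ dyadicTable X₀)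
    {u v ε₀ : ℝ} (hu : u ≠ 0) (hv : v ≠ 0) (h0 : 0 < ε₀) (h1 : ε₀ < 1) (X₀ : Fin 4 → ℝ) :
    ¬ NoGlobalCascade ε₀ (fun (i₁ i₂ i₃ : Fin 4) (μ : ℤ × ℤ × ℤ) => if μ = ((0 : ℤ), (0 : ℤ), (1 : ℤ)) then
        (if (i₁ = 0 ∧ i₂ = 1) ∨ (i₁ = 1 ∧ i₂ = 0) then (if i₃ = 0 then u else if i₃ = 1 then v else 0) else 0)
      else if μ = ((1 : ℤ), (0 : ℤ), (0 : ℤ)) then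
        (if i₁ = 0 ∧ i₂ = 1 ∧ i₃ = 0 then -u else if i₁ = 1 ∧ i₂ = 0 ∧ i₃ = 1 then -v else 0)
      else if μ = ((0 : ℤ), (1 : ℤ), (0 : ℤ)) then
        (if i₁ = 1 ∧ i₂ = 0 ∧ i₃ = 0 then -u else if i₁ = 0 ∧ i₂ = 1 ∧ i₃ = 1 then -v else 0) else 0) (fun i => (fun i : Fin 4 => if i = 0 then (2 * v)⁻¹ else if i = 1 then (2 * u)⁻¹ else (0 : ℝ)) i * X₀ 0) :=
  not_noGlobalCascade_selfDrainPair_of_dyadic hu hv (by linarith) (hD ε₀ h0 h1 X₀)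

end BlowupRigidityOne

end Summit.NavierStokesRegularity.NavierStokesRegularity.Theorems

end
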